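import Literature.NumberTheory.EllipticCurves.ModularCurve
import Literature.NumberTheory.EllipticCurves.QuadraticTwist
import Literature.NumberTheory.EllipticCurves.Isogeny
import Literature.NumberTheory.EllipticCurves.GlobalMinimalModel
import Literature.NumberTheory.DiophantineGeometry.Conductor
import HarnessLib
import HarnessLib.Audit.Tags

/-!
# Candidate E-imc-6: the EXACT degree-ratio law under a ramified twist (`RamifiedTwistExactDegreeRatio p d`)
# and its `p`-adic shadow E-imc-6ₚ (`RamifiedTwistPadicDegreeLaw p d`)
# — cell `bsd-f2-manin` (D-0131 (3) frontier: the Manin constant at additive primes). `@[conjecture]`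
# leaf (NOTHING asserted; definitions only; proved edges in `RamifiedTwistExactEdges.lean`).

HONEST FRAMING. LENS = Iwasawa-main-conjecture / Λ-adic integrality read as RAMIFIED-QUADRATIC-TWIST
laws at the additive prime (planner-of-record `bsd-f2-manin-imc`, HOME
`run/shared/lean/pub/bsd-f2-manin/MEMO-imc.md` §9 (g1), Props VERBATIM from HOME/imc/Sketch-imc-g1.lean
(sha16 eda08fcdae877d26, namespace `BsdF2ManinImc`, farm rc 0) with its three abbreviations inlined:
`pStar p = (((-1)^(p/2) · p : ℤ) : ℚ)`, `IsLatticeOptimal D` = the lattice clause `Λ_W = c·Λ_f`, and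
`IsTwistDiscAt p d` = `(d : ℚ) = pStar p ∨ (p = 2 ∧ (d = -1 ∨ d = 2 ∨ d = -2))` (the admissible twisting
discriminants: `p*` at odd `p`; `−1, ±2` at `p = 2`), exactly as in the landed g0 leaf
`RamifiedTwistDegreeDichotomy`. «Ramified twist pair at `p`»: `W`, `W′` globally minimal models of the
`X₀(N)`-optimal curves of a class `𝒜` and of `𝒜 ⊗ χ_d` (data `D`, `D′` at the CONDUCTOR levels with
the lattice clauses — refuter-1 traps T1/T2/T3 on BOTH curves), both additive at `p` (`p² ∣ N`), SAME
conductor, `W′ ~ W ⊗ χ_d`, here with `E[p]` irreducible and the two classes distinct (non-CM).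

g1's resolution of g0's «orienter» question (memo §9): for such a pair presented as `W′ = C • (W ⊗ χ_d)`
one has `deg′ · c² · u² = |d|·deg · c′²` (tree, PROVED: `ModularParametrizationData.
deg_mul_sq_mul_sq_eq_of_quadraticTwist_pStar`, Watkins 2002 §2.1 / Delaunay 2003) and
`Δ′_min = u⁻¹² d⁶ Δ_min`, hence `6·v_p(deg′) + v_p(Δ_min) − 6·v_p(deg) − v_p(Δ′_min) = 12·(v_p c′ − v_p c)`:
the DATA-VISIBLE invariant `J_p := 6·v_p(deg φ₀) − v_p(Δ_min)` is constant on the twist orbit IFF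
`ord_p` of the Manin constant is (on commuting pairs E-imc-6ₚ ⟺ the landed `RamifiedTwistManinInvariance`,
PROVED in model form at odd `p` in Sketch-imc-g1 `padicValInt_c_eq_iff_padicDegreeLaw`).

THIS ROW (E-imc-6): `deg φ₀(𝒜 ⊗ χ_d)⁶ · p^{v_p Δ_min(𝒜)} = deg φ₀(𝒜)⁶ · p^{v_p Δ_min(𝒜 ⊗ χ_d)}`, i.e.
`deg′/deg = p^{(v_pΔ′_min − v_pΔ_min)/6}` EXACTLY; shadow (E-imc-6ₚ): the same after `v_p`, written
without subtraction. BC5 WITNESS: census v0 (HOME/imc/TWISTCENSUS-v0, N < 10⁵): 0 violations on 164 056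
irreducible non-CM directed rows (p = 2: 41 682; 3: 52 336; 5: 31 026; 7: 17 270; ≥ 11: 21 742); FALSE
without irreducibility (flip rows, e.g. 50a1/50b1 at p = 5). Refuter verdicts: REF1 **SURVIVES**
2026-08-27T15:40Z (HOME/REFUTER-ref1.md §R2.1: independent engine N < 5·10⁵, 0 clean violations /
907 492 directed irreducible rows over 88 primes, 6ₚ 0 / 907 496; 4 crux probes CLEAN; load-bearing: Irr,
IsLatticeOptimal ×2, equal conductor); REF2 (HOME/REFUTER-ref2.md §R2.17): MODULUS IN-PRINT-IMPLICIT,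
SIGN = E-imc-1b (Edixhoven 1991 §4 «deg(φ̃) = p·deg(φ)(c′)²/c²/deg α», in-print sketch at p > 7
potentially supersingular; OPEN-NEW at p ∈ {2, 3, 5, 7}); conjecture-strength = Manin-orbit-invariance.
-/

noncomputable section

open scoped MatrixGroups ModularForm

open CongruenceSubgroup WeierstrassCurve
  Literature.NumberTheory.EllipticCurves Literature.NumberTheory.EllipticCurves.ModularForms

namespace Summit.BirchSwinnertonDyer.Rank1Residual.ManinAdditive

/-- **Candidate E-imc-6 `RamifiedTwistExactDegreeRatio p d` (cell bsd-f2-manin; a LAW, NOT in print,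
nothing asserted):** for a prime `p`, an admissible twisting discriminant `d` (`d = p*` for odd `p`;
`d ∈ {−1, 2, −2}` at `p = 2`), and a ramified twist pair of `X₀(N)`-optimal curves `(W, D)`, `(W′, D′)`
(globally minimal models, data at the conductor levels with the lattice clauses `Λ = c·Λ_f`) at the
same conductor with `p² ∣ N`, `W′ ~ W ⊗ χ_d`, `E[p]` irreducible and the two classes distinct:
`deg(φ_{D′})⁶ · p^{v_p Δ_min(W)} = deg(φ_D)⁶ · p^{v_p Δ_min(W′)}`.
[cite: Watkins2002, §2.1 p. 491 (shape only: the degree identity under twists «if we assume the Manin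
constants are the same»; the exact law for OPTIMAL degrees is NOT in print — cell bsd-f2-manin
MEMO-imc.md §9, E-imc-6)] -/
@[conjecture] def RamifiedTwistExactDegreeRatio (p : ℕ) (d : ℤ) : Prop :=
  ∀ (W W' : WeierstrassCurve ℚ) [W.IsElliptic] [W.IsGloballyMinimal] [W'.IsElliptic]
    [W'.IsGloballyMinimal] [NeZero (W.conductorNorm ℤ)] [NeZero (W'.conductorNorm ℤ)]
    (D : ModularParametrizationData W (W.conductorNorm ℤ))
    (D' : ModularParametrizationData W' (W'.conductorNorm ℤ)),
    p.Prime → ((d : ℚ) = ((((-1 : ℤ) ^ (p / 2) * p : ℤ) : ℚ)) ∨ (p = 2 ∧ (d = -1 ∨ d = 2 ∨ d = -2))) →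
    (∀ z ∈ D.L.lattice, ∃ w ∈ periodLattice D.f, z = D.c * w) →
    (∀ z ∈ D'.L.lattice, ∃ w ∈ periodLattice D'.f, z = D'.c * w) →
    p ^ 2 ∣ W.conductorNorm ℤ → W'.conductorNorm ℤ = W.conductorNorm ℤ →
    IsIsogenous (W.quadraticTwist (d : ℚ)) W' →
    W.HasIrreducibleModPGaloisRep p →
    ¬ IsIsogenous W W' →
    D'.modularDegree ^ 6 * p ^ padicValInt p W.minimalDiscriminantInt =
      D.modularDegree ^ 6 * p ^ padicValInt p W'.minimalDiscriminantInt

/-- **Candidate E-imc-6ₚ `RamifiedTwistPadicDegreeLaw p d` (cell bsd-f2-manin; the `p`-adic shadow of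
E-imc-6, nothing asserted):** same binders; conclusion = invariance of `J_p := 6·v_p(deg φ) − v_p(Δ_min)`
on the twist orbit, written without subtraction:
`6·v_p(deg φ_{D′}) + v_p(Δ_min W) = 6·v_p(deg φ_D) + v_p(Δ_min W′)`.
[cite: Watkins2002, §2.1 p. 491 (shape only; NOT in print for optimal degrees — cell bsd-f2-manin
MEMO-imc.md §9, E-imc-6ₚ)] -/
@[conjecture] def RamifiedTwistPadicDegreeLaw (p : ℕ) (d : ℤ) : Prop :=
  ∀ (W W' : WeierstrassCurve ℚ) [W.IsElliptic] [W.IsGloballyMinimal] [W'.IsElliptic]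
    [W'.IsGloballyMinimal] [NeZero (W.conductorNorm ℤ)] [NeZero (W'.conductorNorm ℤ)]
    (D : ModularParametrizationData W (W.conductorNorm ℤ))
    (D' : ModularParametrizationData W' (W'.conductorNorm ℤ)),
    p.Prime → ((d : ℚ) = ((((-1 : ℤ) ^ (p / 2) * p : ℤ) : ℚ)) ∨ (p = 2 ∧ (d = -1 ∨ d = 2 ∨ d = -2))) →
    (∀ z ∈ D.L.lattice, ∃ w ∈ periodLattice D.f, z = D.c * w) →
    (∀ z ∈ D'.L.lattice, ∃ w ∈ periodLattice D'.f, z = D'.c * w) →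
    p ^ 2 ∣ W.conductorNorm ℤ → W'.conductorNorm ℤ = W.conductorNorm ℤ →
    IsIsogenous (W.quadraticTwist (d : ℚ)) W' →
    W.HasIrreducibleModPGaloisRep p →
    ¬ IsIsogenous W W' →
    6 * padicValNat p D'.modularDegree + padicValInt p W.minimalDiscriminantInt =
      6 * padicValNat p D.modularDegree + padicValInt p W'.minimalDiscriminantInt

end Summit.BirchSwinnertonDyer.Rank1Residual.ManinAdditive

end
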